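import Summits.AtomisticToContinuum.HydrodynamicLimit.Theorems.StiffCollisionalRelaxationAprioriBoundsMesoOccupationInProbExact
import HarnessLib

/-!
# Component (i) of the a-priori crux IS a uniform exponential envelope of the time-averaged occupations, in probability
(line `meso-chebyshev-window`, crux `AprioriBounds` = stmt-AtomisticToContinuum-14827, lead c11, cycle 4)

Support file (`--supports stmt-AtomisticToContinuum-14827`).  With `occ_K(z) := (∫⁻₀ᵗ frac_K(Φ_s z) ds).toReal` and
`X_N^λ(z) := ∫₀ᵗ (N+1)⁻¹∑ᵢ e^{λ|vᵢ(s)|²} ds`, component (i) (`PartOneAt`: `∃ λ > 0, C, P_N{C < X_N^λ} → 0`) is EQUIVALENT — with no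
far-tail, normalisation or profile hypothesis — to the UNIFORM ENVELOPE IN PROBABILITY
  `∃ λ > 0, C, P_N{∃ K, C·e^{−λK} < occ_K} → 0`
(`partOne_iff_uniformEnvelope`; levels `K ∈ ℕ` suffice, `K ∈ ℝ` are implied):
* `⟹` (`uniformEnvelope_of_partOne`): `e^{λK}·occ_K ≤ X_N^λ` on good orbits for EVERY level simultaneously
  (`exp_mul_occupation_le_timeAvg_expMoment`, p172293), so one (i)-event covers all levels;
* `⟸` (`partOne_of_uniformEnvelope`): off the envelope-violation event the layer cake over integer levels
  (`occ_lintegral_orbit_expAvg_le` with no level cut) bounds `X_N^{λ/2} ≤ C⁺e^{λ/2}/(1 − e^{−λ/2})` SURELY — no Markov step, hence no tails in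
  the mean.
So the exact per-level child `OccupationInProb` (p172293: `PartOneAt ⟹ OccupationInProb`; `OccupationInProb ∧ FarTailAllAt ⟹ PartOneAt`) and (i)
differ exactly by UNIFORMITY IN THE LEVEL, and the far tails in the mean (stmt-14415) are used for nothing but `per-level ⟹ uniform` (Markov on
the top levels inside the landed dial).  A producer of the uniform envelope (e.g. an in-probability maximal-velocity bound
`max_i sup_{s ≤ t} |vᵢ(s)|² ≤ λ⁻¹ log(C(N+1))`) would give (i) WITHOUT stmt-14415.

No new definitions, no named facts; axioms `propext`, `Classical.choice`, `Quot.sound`.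
-/

noncomputable section

open MeasureTheory ProbabilityTheory Filter Set Topology
open scoped ENNReal

namespace Summit.AtomisticToContinuum.HydrodynamicLimit.Theorems.MesoChebyshevWindow

open Literature.MathematicalPhysics.KineticTheory Literature.Analysis.FluidPDE
open Summit.AtomisticToContinuum.HydrodynamicLimit.Theorems.AprioriBoundsNegative (PartOneAt PartTwoAt)
open Summit.AtomisticToContinuum.HydrodynamicLimit.Theorems.VisitLedgerUpscattering (Cfg Flow Flows NiceProfiles)
open Summit.AtomisticToContinuum.HydrodynamicLimit.Theorems.FibreDeficitTransfer

/-! ## Off the envelope-violation event the exponential moment is bounded surely -/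

/-- **Layer cake under an exponential envelope.**  On a good orbit, if `occ_K ≤ C⁺e^{−λK}` for every INTEGER level `K`, then for
`0 ≤ λ' < λ`: `∫⁻₀ᵗ (N+1)⁻¹∑ᵢ e^{λ'|vᵢ(s)|²} ds ≤ C⁺e^{λ'}/(1 − e^{−(λ−λ')})` (`occ_lintegral_orbit_expAvg_le` with no level cut, then a
geometric series). -/
theorem lintegral_expAvg_le_of_envelope {N : ℕ} {ε : ℝ}
    (Φ : HardSphereFlow (Torus.geometry (Fin 3)) ε (N + 1)) {z : Cfg N} (hz : z ∈ Φ.good)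
    {lam lam' C : ℝ} (hlam' : 0 ≤ lam') (hll : lam' < lam) (t : ℝ)
    (henv : ∀ K : ℕ, (∫⁻ s in Icc 0 t, ENNReal.ofReal (frac (K : ℝ) (Φ.flow s z))).toReal ≤
      max C 0 * Real.exp (-(lam * K))) :
    ∫⁻ s in Icc 0 t, ENNReal.ofReal (((N + 1 : ℕ) : ℝ)⁻¹ * ∑ i, Real.exp (lam' * ‖(Φ.flow s z i).2‖ ^ 2)) ≤
      ENNReal.ofReal (max C 0 * Real.exp lam' / (1 - Real.exp (-(lam - lam')))) := by
  set ν : Measure ℝ := volume.restrict (Icc 0 t) with hν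
  set ρ : ℝ := Real.exp (-(lam - lam')) with hρ
  have hρ0 : 0 ≤ ρ := (Real.exp_pos _).le
  have hρ1 : ρ < 1 := Real.exp_lt_one_iff.2 (by linarith)
  have hC0 : 0 ≤ max C 0 := le_max_right _ _
  set B : ℝ := max C 0 * Real.exp lam' with hB
  have hB0 : 0 ≤ B := by positivity
  set I : ℕ → ℝ≥0∞ := fun K => ∫⁻ s, ENNReal.ofReal (frac (K : ℝ) (Φ.flow s z)) ∂ν with hI
  have hfin : ∀ K, I K ≠ ⊤ := by
    intro K
    refine ne_top_of_le_ne_top (b := ∫⁻ _s, (1 : ℝ≥0∞) ∂ν) ?_ (lintegral_mono fun s => ?_)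
    · rw [lintegral_const, hν, Measure.restrict_apply_univ, Real.volume_Icc, one_mul]
      exact ENNReal.ofReal_ne_top
    · calc ENNReal.ofReal (frac (K : ℝ) (Φ.flow s z)) ≤ ENNReal.ofReal 1 :=
          ENNReal.ofReal_le_ofReal (frac_mem_Icc _ _).2
        _ = 1 := ENNReal.ofReal_one
  -- each level: `e^{λ'(K+1)} I_K ≤ B ρ^K`
  have hlev : ∀ K : ℕ, ENNReal.ofReal (Real.exp (lam' * ((K : ℝ) + 1))) * I K ≤ ENNReal.ofReal (B * ρ ^ K) := by
    intro K
    have hIK : I K ≤ ENNReal.ofReal (max C 0 * Real.exp (-(lam * K))) := by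
      rw [← ENNReal.ofReal_toReal (hfin K)]
      exact ENNReal.ofReal_le_ofReal (henv K)
    have halg : Real.exp (lam' * ((K : ℝ) + 1)) * (max C 0 * Real.exp (-(lam * K))) = B * ρ ^ K := by
      rw [hB, hρ, ← Real.exp_nat_mul]
      have e1 : Real.exp (lam' * ((K : ℝ) + 1)) * Real.exp (-(lam * K)) =
          Real.exp lam' * Real.exp ((K : ℕ) * -(lam - lam')) := by
        rw [← Real.exp_add, ← Real.exp_add]
        congr 1
        ring
      calc Real.exp (lam' * ((K : ℝ) + 1)) * (max C 0 * Real.exp (-(lam * K)))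
          = max C 0 * (Real.exp (lam' * ((K : ℝ) + 1)) * Real.exp (-(lam * K))) := by ring
        _ = max C 0 * (Real.exp lam' * Real.exp ((K : ℕ) * -(lam - lam'))) := by rw [e1]
        _ = max C 0 * Real.exp lam' * Real.exp ((K : ℕ) * -(lam - lam')) := by ring
    calc ENNReal.ofReal (Real.exp (lam' * ((K : ℝ) + 1))) * I K
        ≤ ENNReal.ofReal (Real.exp (lam' * ((K : ℝ) + 1))) * ENNReal.ofReal (max C 0 * Real.exp (-(lam * K))) :=
          mul_le_mul' le_rfl hIK
      _ = ENNReal.ofReal (B * ρ ^ K) := by rw [← ENNReal.ofReal_mul (Real.exp_pos _).le, halg]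
  have h := occ_lintegral_orbit_expAvg_le Φ hz hlam' t 0
  simp only [Finset.range_zero, Finset.sum_empty, zero_add, Nat.add_zero] at h
  calc ∫⁻ s, ENNReal.ofReal (((N + 1 : ℕ) : ℝ)⁻¹ * ∑ i, Real.exp (lam' * ‖(Φ.flow s z i).2‖ ^ 2)) ∂ν
      ≤ ∑' K : ℕ, ENNReal.ofReal (Real.exp (lam' * ((K : ℝ) + 1))) * I K := h
    _ ≤ ∑' K : ℕ, ENNReal.ofReal B * ENNReal.ofReal ρ ^ K := by
        refine ENNReal.tsum_le_tsum fun K => ?_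
        rw [← ENNReal.ofReal_pow hρ0, ← ENNReal.ofReal_mul hB0]
        exact hlev K
    _ = ENNReal.ofReal B * (1 - ENNReal.ofReal ρ)⁻¹ := by rw [ENNReal.tsum_mul_left, ENNReal.tsum_geometric]
    _ = ENNReal.ofReal (B / (1 - ρ)) := by
        rw [← ENNReal.ofReal_one, ← ENNReal.ofReal_sub _ hρ0, ← ENNReal.ofReal_inv_of_pos (sub_pos.2 hρ1),
          ← ENNReal.ofReal_mul hB0, div_eq_mul_inv]

/-- **At one particle number: the (i)-event at `λ' = λ/2` with threshold `C⁺e^{λ/2}/(1 − e^{−λ/2}) + 1` sits inside the envelope-violation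
event** (up to the null set of bad orbits): off the violation event the moment is bounded surely (`lintegral_expAvg_le_of_envelope`), and on
good orbits the Bochner time integral is the lower Lebesgue one (bounded integrand by energy conservation). -/
theorem measure_partOneEvent_le_envelopeEvent {σ : ℝ} {a₀ θ₀ : T3 → ℝ} {u₀ : T3 → V3} {N : ℕ}
    (Φ : HardSphereFlow (Torus.geometry (Fin 3)) (hsDiameter σ N) (N + 1))
    {lam : ℝ} (hlam : 0 < lam) (C t : ℝ) :
    localGibbsLaw σ a₀ u₀ θ₀ N Φ
        {z | max C 0 * Real.exp (lam / 2) / (1 - Real.exp (-(lam / 2))) + 1 <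
          ∫ s in Icc 0 t, ∫ y, Real.exp (lam / 2 * ‖y.2‖ ^ 2) ∂(empiricalMeasure (Φ.flow s z))} ≤
      localGibbsLaw σ a₀ u₀ θ₀ N Φ
        {z | ∃ K : ℕ, max C 0 * Real.exp (-(lam * K)) <
          (∫⁻ s in Icc 0 t, ENNReal.ofReal (frac (K : ℝ) (Φ.flow s z))).toReal} := by
  set P : Measure (Cfg N) := localGibbsLaw σ a₀ u₀ θ₀ N Φ with hPdef
  have hgood0 : P Φ.goodᶜ = 0 := by
    rw [hPdef, localGibbsLaw_eq]
    exact (localGibbsMeasure_absolutelyContinuous σ _ _ _ N Φ) Φ.measure_compl_good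
  set lam' : ℝ := lam / 2 with hlam'
  have hlam'0 : 0 ≤ lam' := by positivity
  have hll : lam' < lam := by rw [hlam']; linarith
  have hsub : lam - lam' = lam' := by rw [hlam']; ring
  set C' : ℝ := max C 0 * Real.exp lam' / (1 - Real.exp (-lam')) with hC'
  have h1q : 0 < 1 - Real.exp (-lam') := sub_pos.2 (Real.exp_lt_one_iff.2 (by linarith))
  have hC'0 : 0 ≤ C' := by positivity
  set G : Cfg N → ℝ := fun w => ((N + 1 : ℕ) : ℝ)⁻¹ * ∑ i, Real.exp (lam' * ‖(w i).2‖ ^ 2) with hG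
  have hGm : Measurable G :=
    measurable_const.mul (Finset.measurable_sum _ fun i _ =>
      (measurable_pi_apply i).snd.norm.pow_const 2 |>.const_mul lam' |>.exp)
  have hG0 : ∀ w, 0 ≤ G w := fun w => mul_nonneg (by positivity) (Finset.sum_nonneg fun i _ => (Real.exp_pos _).le)
  have hincl : {z : Cfg N | C' + 1 < ∫ s in Icc 0 t, ∫ y, Real.exp (lam' * ‖y.2‖ ^ 2) ∂(empiricalMeasure (Φ.flow s z))} ⊆
      Φ.goodᶜ ∪ {z | ∃ K : ℕ, max C 0 * Real.exp (-(lam * K)) <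
        (∫⁻ s in Icc 0 t, ENNReal.ofReal (frac (K : ℝ) (Φ.flow s z))).toReal} := by
    intro z hz1
    by_cases hz : z ∈ Φ.good
    swap; · exact Or.inl hz
    right
    by_contra henv
    simp only [mem_setOf_eq, not_exists, not_lt] at henv
    simp only [mem_setOf_eq, integral_empiricalMeasure] at hz1
    -- on the good orbit the Bochner integral is the lintegral, which the envelope bounds by `C'`
    have horb : Measurable fun s => Φ.flow s z := (Φ.isTrajectory z hz).measurable_torus
    have hbdd : ∀ s, G (Φ.flow s z) ≤ Real.exp (lam' * (2 * configEnergy z)) := fun s =>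
      Φ.configEnergy_flow hz s ▸ AprioriBoundsNegative.expAvg_le_exp_lam_energy (N := N) hlam'0 (Φ.flow s z)
    have hGi : Integrable (fun s => G (Φ.flow s z)) (volume.restrict (Icc 0 t)) := by
      refine Measure.integrableOn_of_bounded (M := Real.exp (lam' * (2 * configEnergy z)))
        measure_Icc_lt_top.ne (hGm.comp horb).aestronglyMeasurable (ae_of_all _ fun s => ?_)
      rw [Real.norm_eq_abs, abs_of_nonneg (hG0 _)]
      exact hbdd s
    have hX : ENNReal.ofReal (∫ s in Icc 0 t, G (Φ.flow s z)) =
        ∫⁻ s in Icc 0 t, ENNReal.ofReal (G (Φ.flow s z)) :=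
      ofReal_integral_eq_lintegral_ofReal hGi (ae_of_all _ fun s => hG0 _)
    have hle : ∫⁻ s in Icc 0 t, ENNReal.ofReal (G (Φ.flow s z)) ≤ ENNReal.ofReal C' := by
      have h := lintegral_expAvg_le_of_envelope Φ hz hlam'0 hll t henv
      rwa [hsub] at h
    have hXle : ∫ s in Icc 0 t, G (Φ.flow s z) ≤ C' := by
      have h := hX.trans_le hle
      exact (ENNReal.ofReal_le_ofReal_iff hC'0).1 h
    have hz1' : C' + 1 < ∫ s in Icc 0 t, G (Φ.flow s z) := hz1
    linarith
  calc P {z | C' + 1 < ∫ s in Icc 0 t, ∫ y, Real.exp (lam' * ‖y.2‖ ^ 2) ∂(empiricalMeasure (Φ.flow s z))}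
      ≤ P (Φ.goodᶜ ∪ {z | ∃ K : ℕ, max C 0 * Real.exp (-(lam * K)) <
          (∫⁻ s in Icc 0 t, ENNReal.ofReal (frac (K : ℝ) (Φ.flow s z))).toReal}) := measure_mono hincl
    _ ≤ P Φ.goodᶜ + P {z | ∃ K : ℕ, max C 0 * Real.exp (-(lam * K)) <
          (∫⁻ s in Icc 0 t, ENNReal.ofReal (frac (K : ℝ) (Φ.flow s z))).toReal} := measure_union_le _ _
    _ = _ := by rw [hgood0, zero_add]

/-! ## The equivalence -/

/-- **(i) from a uniform exponential envelope in probability over the INTEGER levels — no far tails, no normalisation, no profiles.** -/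
theorem partOne_of_uniformEnvelope :
    ∀ (σ : ℝ) (a₀ θ₀ : T3 → ℝ) (u₀ : T3 → V3)
      (Φ : (N : ℕ) → HardSphereFlow (Torus.geometry (Fin 3)) (hsDiameter σ N) (N + 1)) (t : ℝ),
      (∃ lam C : ℝ, 0 < lam ∧ Tendsto (fun N : ℕ => localGibbsLaw σ a₀ u₀ θ₀ N (Φ N)
        {z | ∃ K : ℕ, C * Real.exp (-(lam * K)) <
          (∫⁻ s in Icc 0 t, ENNReal.ofReal (frac (K : ℝ) ((Φ N).flow s z))).toReal}) atTop (𝓝 0)) →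
      PartOneAt σ a₀ θ₀ u₀ Φ t := by
  intro σ a₀ θ₀ u₀ Φ t h
  obtain ⟨lam, C, hlam, hT⟩ := h
  refine ⟨lam / 2, max C 0 * Real.exp (lam / 2) / (1 - Real.exp (-(lam / 2))) + 1, by positivity, ?_⟩
  refine tendsto_of_tendsto_of_tendsto_of_le_of_le tendsto_const_nhds hT (fun _ => zero_le) fun N => ?_
  refine (measure_partOneEvent_le_envelopeEvent (Φ N) hlam C t).trans (measure_mono fun z hz => ?_)
  obtain ⟨K, hK⟩ := hz
  refine ⟨K, lt_of_le_of_lt ?_ hK⟩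
  exact mul_le_mul_of_nonneg_right (le_max_left C 0) (Real.exp_pos _).le

/-- **A uniform exponential envelope in probability over ALL REAL levels from (i)** (`C := C⁺` of the (i)-witness, same `λ`): one (i)-event
covers every level, since `e^{λK}·occ_K ≤ X_N^λ` on good orbits (`exp_mul_occupation_le_timeAvg_expMoment`). -/
theorem uniformEnvelope_of_partOne :
    ∀ (σ : ℝ) (a₀ θ₀ : T3 → ℝ) (u₀ : T3 → V3)
      (Φ : (N : ℕ) → HardSphereFlow (Torus.geometry (Fin 3)) (hsDiameter σ N) (N + 1)) (t : ℝ),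
      PartOneAt σ a₀ θ₀ u₀ Φ t →
        ∃ lam C : ℝ, 0 < lam ∧ Tendsto (fun N : ℕ => localGibbsLaw σ a₀ u₀ θ₀ N (Φ N)
          {z | ∃ K : ℝ, C * Real.exp (-(lam * K)) <
            (∫⁻ s in Icc 0 t, ENNReal.ofReal (frac K ((Φ N).flow s z))).toReal}) atTop (𝓝 0) := by
  intro σ a₀ θ₀ u₀ Φ t h
  obtain ⟨lam, Cexp, hlam, hT⟩ := h
  refine ⟨lam, max Cexp 0, hlam, ?_⟩
  refine tendsto_of_tendsto_of_tendsto_of_le_of_le tendsto_const_nhds hT (fun _ => zero_le) fun N => ?_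
  set P : Measure (Cfg N) := localGibbsLaw σ a₀ u₀ θ₀ N (Φ N) with hPdef
  have hgood0 : P (Φ N).goodᶜ = 0 := by
    rw [hPdef, localGibbsLaw_eq]
    exact (localGibbsMeasure_absolutelyContinuous σ _ _ _ N (Φ N)) (Φ N).measure_compl_good
  have hincl : {z : Cfg N | ∃ K : ℝ, max Cexp 0 * Real.exp (-(lam * K)) <
        (∫⁻ s in Icc 0 t, ENNReal.ofReal (frac K ((Φ N).flow s z))).toReal} ⊆
      (Φ N).goodᶜ ∪ {z | Cexp < ∫ s in Icc 0 t, ∫ y, Real.exp (lam * ‖y.2‖ ^ 2) ∂(empiricalMeasure ((Φ N).flow s z))} := by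
    rintro z ⟨K, hK⟩
    by_cases hz : z ∈ (Φ N).good
    swap; · exact Or.inl hz
    right
    simp only [mem_setOf_eq, integral_empiricalMeasure]
    have horb := exp_mul_occupation_le_timeAvg_expMoment (Φ N) hz hlam.le K t
    have hE : 0 < Real.exp (lam * K) := Real.exp_pos _
    have hEE : Real.exp (lam * K) * Real.exp (-(lam * K)) = 1 := by
      rw [← Real.exp_add, add_neg_cancel, Real.exp_zero]
    have h2 : max Cexp 0 < Real.exp (lam * K) * (∫⁻ s in Icc 0 t, ENNReal.ofReal (frac K ((Φ N).flow s z))).toReal :=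
      calc max Cexp 0 = Real.exp (lam * K) * (max Cexp 0 * Real.exp (-(lam * K))) := by
            linear_combination (-(max Cexp 0)) * hEE
        _ < _ := mul_lt_mul_of_pos_left hK hE
    exact (le_max_left Cexp 0).trans_lt (h2.trans_le horb)
  calc P _ ≤ P ((Φ N).goodᶜ ∪ _) := measure_mono hincl
    _ ≤ P (Φ N).goodᶜ + P _ := measure_union_le _ _
    _ = _ := by rw [hgood0, zero_add]

/-- **`PartOneAt ⟺ uniform exponential envelope of the time-averaged occupations in probability`** (integer levels; the real-level form is
implied by `uniformEnvelope_of_partOne`).  No far-tail / normalisation / profile hypothesis on either side. -/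
theorem partOne_iff_uniformEnvelope (σ : ℝ) (a₀ θ₀ : T3 → ℝ) (u₀ : T3 → V3)
    (Φ : (N : ℕ) → HardSphereFlow (Torus.geometry (Fin 3)) (hsDiameter σ N) (N + 1)) (t : ℝ) :
    PartOneAt σ a₀ θ₀ u₀ Φ t ↔
      ∃ lam C : ℝ, 0 < lam ∧ Tendsto (fun N : ℕ => localGibbsLaw σ a₀ u₀ θ₀ N (Φ N)
        {z | ∃ K : ℕ, C * Real.exp (-(lam * K)) <
          (∫⁻ s in Icc 0 t, ENNReal.ofReal (frac (K : ℝ) ((Φ N).flow s z))).toReal}) atTop (𝓝 0) := by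
  refine ⟨fun h => ?_, partOne_of_uniformEnvelope σ a₀ θ₀ u₀ Φ t⟩
  obtain ⟨lam, C, hlam, hT⟩ := uniformEnvelope_of_partOne σ a₀ θ₀ u₀ Φ t h
  refine ⟨lam, C, hlam, tendsto_of_tendsto_of_tendsto_of_le_of_le tendsto_const_nhds hT (fun _ => zero_le) fun N =>
    measure_mono ?_⟩
  rintro z ⟨K, hK⟩
  exact ⟨(K : ℝ), hK⟩

end Summit.AtomisticToContinuum.HydrodynamicLimit.Theorems.MesoChebyshevWindow

end
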